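import Summits.Ventures.PercRepro.SevenThreeNullity

/-!
# PercRepro — the `(7,3)` cell: the bookkeeping identity of Theorem P₁(7,3) (p3, gen 15)

The reduced world of a `3`-point flat `T` (mine-2 §24.1 / §27.1): `M` simple, `T` a `3`-point set of rank `3`, `W` an
independent `7`-set disjoint from `T` with no point of `W` in `cl(T)`. For `X ⊆ W` put `S = T ∪ X`; `S` is a WITNESS when
`4 ≤ ρ(S) ≤ 6`, and it then gives `T` the share `1/D(S)`. The supply of `T` is `supply T W = Σ_{witnesses} 1/D(T ∪ X)`, and
`Φ(7,3) = 28/5 = Σ_{x=1}^{3} C(7, x)/C(x+3, 3)` is the generic supply. This file proves the bookkeeping of §27.1: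
* `supply_sub_phi_eq_sum_bracket`: `supply T W − 28/5 = Σ_{∅ ≠ X ⊆ W} bracket X`, with
  `bracket X = [witness]/D(T ∪ X) − [|X| ≤ 3]/C(|X|+3, 3)`;
* `bracket_eq_zero_of_indep`: the bracket vanishes when `T ∪ X` is independent (nullity `0`: the share is the generic one
  for `|X| ≤ 3`, and `T ∪ X` is not a witness for `|X| ≥ 4`);
* `eRk_union_bounds`: `|X| ≤ ρ(T ∪ X) ≤ |X| + 3` (so the nullity of `T ∪ X` is at most `3`).
What remains for Theorem P₁(7,3) (`P3-C025-seven-three-plan.md` §6): the brackets of nullity `1` and `2` grouped by the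
cyclic part (M5, with the two kernel tables `SevenThreeLineTable` / `SevenThreeStarTable`) and the nullity-`2` structure (M4).
-/

namespace PercRepro

namespace SevenThree

open Finset ThmH SixThree

variable {α : Type*} [DecidableEq α] {M : Matroid α} [M.Finite]

/-- The hypotheses of the reduced world: `M` simple, `T` a `3`-point set of rank `3`, `W ⊆ E` independent with `7` points,
disjoint from `T`, no point of `W` in `cl(T)`. -/
structure ReducedWorld (M : Matroid α) [M.Finite] (T W : Finset α) : Prop where
  simple : Simple M
  T_sub : T ⊆ gr M
  T_card : T.card = 3
  T_rank : M.eRk (T : Set α) = 3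
  W_sub : W ⊆ gr M
  W_indep : M.Indep (W : Set α)
  W_card : W.card = 7
  disj : Disjoint T W
  flat : ∀ w ∈ W, w ∉ M.closure (T : Set α)

/-- `T ∪ X` is a witness: rank strictly between `3` and `7`. -/
def IsWitness (M : Matroid α) [M.Finite] (T X : Finset α) : Prop :=
  (3 : ℕ∞) < M.eRk ((T ∪ X : Finset α) : Set α) ∧ M.eRk ((T ∪ X : Finset α) : Set α) < 7

open scoped Classical in
/-- The supply of `T` from the subsets of `W`: `Σ_{X ⊆ W, T ∪ X a witness} 1/D(T ∪ X)`. -/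
noncomputable def supply (M : Matroid α) [M.Finite] (T W : Finset α) : ℚ :=
  ∑ X ∈ W.powerset.filter (fun X => IsWitness M T X), 1 / D M (T ∪ X)

open scoped Classical in
/-- The bracket of `X`: the share if `T ∪ X` is a witness, minus the generic share `1/C(|X|+3, 3)` when `|X| ≤ 3`. -/
noncomputable def bracket (M : Matroid α) [M.Finite] (T X : Finset α) : ℚ :=
  (if IsWitness M T X then 1 / D M (T ∪ X) else 0) - (if X.card ≤ 3 then 1 / ((X.card + 3).choose 3 : ℚ) else 0)

/-- The generic supply `Φ(7,3) = Σ_{x=1}^{3} C(7,x)/C(x+3,3) = 28/5`. -/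
theorem phi_seven_three : (7 : ℚ) / 4 + 21 / 10 + 35 / 20 = 28 / 5 := by norm_num

/-- The sum of the generic shares over the nonempty subsets of a `7`-set with at most `3` points is `28/5`. -/
theorem sum_generic_shares {W : Finset α} (hW : W.card = 7) :
    ∑ X ∈ W.powerset.filter (fun X => X ≠ ∅ ∧ X.card ≤ 3), 1 / (((X.card + 3).choose 3 : ℕ) : ℚ) = 28 / 5 := by
  classical
  have hsplit : W.powerset.filter (fun X => X ≠ ∅ ∧ X.card ≤ 3) =
      (W.powersetCard 1 ∪ W.powersetCard 2) ∪ W.powersetCard 3 := by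
    ext X
    simp only [Finset.mem_filter, Finset.mem_powerset, Finset.mem_union, Finset.mem_powersetCard]
    constructor
    · rintro ⟨hXW, hne, hle⟩
      have hpos : 0 < X.card := Finset.card_pos.2 (Finset.nonempty_iff_ne_empty.2 hne)
      have h123 : X.card = 1 ∨ X.card = 2 ∨ X.card = 3 := by omega
      rcases h123 with h1 | h2 | h3
      · exact Or.inl (Or.inl ⟨hXW, h1⟩)
      · exact Or.inl (Or.inr ⟨hXW, h2⟩)
      · exact Or.inr ⟨hXW, h3⟩
    · have hne_of : ∀ {n : ℕ}, X.card = n → 1 ≤ n → X ≠ ∅ := fun hc hn =>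
        Finset.nonempty_iff_ne_empty.1 (Finset.card_pos.1 (by omega))
      rintro ((⟨h, hc⟩ | ⟨h, hc⟩) | ⟨h, hc⟩)
      · exact ⟨h, hne_of hc (by norm_num), by omega⟩
      · exact ⟨h, hne_of hc (by norm_num), by omega⟩
      · exact ⟨h, hne_of hc (by norm_num), by omega⟩
  have hd12 : Disjoint (W.powersetCard 1) (W.powersetCard 2) := by
    rw [Finset.disjoint_left]
    intro X h1 h2
    rw [Finset.mem_powersetCard] at h1 h2
    omega
  have hd3 : Disjoint (W.powersetCard 1 ∪ W.powersetCard 2) (W.powersetCard 3) := by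
    rw [Finset.disjoint_left]
    intro X h1 h3
    rw [Finset.mem_union, Finset.mem_powersetCard, Finset.mem_powersetCard] at h1
    rw [Finset.mem_powersetCard] at h3
    omega
  have hconst : ∀ k : ℕ, ∑ X ∈ W.powersetCard k, 1 / (((X.card + 3).choose 3 : ℕ) : ℚ) =
      (W.card.choose k : ℚ) * (1 / (((k + 3).choose 3 : ℕ) : ℚ)) := by
    intro k
    rw [Finset.sum_congr rfl (fun X hX => by rw [(Finset.mem_powersetCard.1 hX).2]), Finset.sum_const,
      Finset.card_powersetCard, nsmul_eq_mul]
  rw [hsplit, Finset.sum_union hd3, Finset.sum_union hd12, hconst, hconst, hconst, hW]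
  norm_num [Nat.choose]

/-- **The bookkeeping identity** (§27.1): `supply T W − 28/5 = Σ_{∅ ≠ X ⊆ W} bracket X`. -/
theorem supply_sub_phi_eq_sum_bracket {T W : Finset α} (h : ReducedWorld M T W) :
    supply M T W - 28 / 5 = ∑ X ∈ W.powerset.filter (fun X => X ≠ ∅), bracket M T X := by
  classical
  unfold supply bracket
  rw [Finset.sum_sub_distrib]
  congr 1
  · -- the witness sum: a witness `X` is nonempty (`T` alone has rank `3`)
    rw [Finset.sum_filter, Finset.sum_filter]
    apply Finset.sum_congr rfl
    intro X hX
    by_cases hw : IsWitness M T X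
    · have hne : X ≠ ∅ := by
        rintro rfl
        unfold IsWitness at hw
        rw [Finset.union_empty, h.T_rank] at hw
        exact lt_irrefl _ hw.1
      simp [hw, hne]
    · simp [hw]
  · -- the generic sum
    rw [← sum_generic_shares h.W_card, Finset.sum_filter, Finset.sum_filter]
    apply Finset.sum_congr rfl
    intro X _
    by_cases hne : X ≠ ∅ <;> by_cases hle : X.card ≤ 3 <;> simp [hne, hle]

/-- The rank of `T ∪ X` in the reduced world: `|X| ≤ ρ(T ∪ X) ≤ |X| + 3`. -/
theorem eRk_union_bounds {T W X : Finset α} (h : ReducedWorld M T W) (hX : X ⊆ W) :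
    (X.card : ℕ∞) ≤ M.eRk ((T ∪ X : Finset α) : Set α) ∧ M.eRk ((T ∪ X : Finset α) : Set α) ≤ (X.card : ℕ∞) + 3 := by
  constructor
  · have hind : M.Indep (X : Set α) := h.W_indep.subset (Finset.coe_subset.2 hX)
    calc (X.card : ℕ∞) = M.eRk (X : Set α) := by rw [hind.eRk_eq_encard, Set.encard_coe_eq_coe_finsetCard]
      _ ≤ M.eRk ((T ∪ X : Finset α) : Set α) := M.eRk_mono (Finset.coe_subset.2 Finset.subset_union_right)
  · calc M.eRk ((T ∪ X : Finset α) : Set α) = M.eRk ((T : Set α) ∪ (X : Set α)) := by rw [Finset.coe_union]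
      _ ≤ M.eRk (T : Set α) + M.eRk (X : Set α) := M.eRk_union_le_eRk_add_eRk _ _
      _ = 3 + (X.card : ℕ∞) := by
          have hind : M.Indep (X : Set α) := h.W_indep.subset (Finset.coe_subset.2 hX)
          rw [h.T_rank, hind.eRk_eq_encard, Set.encard_coe_eq_coe_finsetCard]
      _ = (X.card : ℕ∞) + 3 := add_comm _ _

/-- **Nullity `0` contributes nothing**: if `T ∪ X` is independent the bracket vanishes — the share is the generic
`1/C(|X|+3, 3)` for `|X| ≤ 3`, and `T ∪ X` is not a witness for `|X| ≥ 4`. -/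
theorem bracket_eq_zero_of_indep {T W X : Finset α} (h : ReducedWorld M T W) (hX : X ⊆ W) (hne : X ≠ ∅)
    (hind : M.Indep ((T ∪ X : Finset α) : Set α)) : bracket M T X = 0 := by
  classical
  have hpos : 1 ≤ X.card := Finset.card_pos.2 (Finset.nonempty_iff_ne_empty.2 hne)
  have hcard : (T ∪ X).card = X.card + 3 := by
    rw [Finset.card_union_of_disjoint (h.disj.mono_right hX), h.T_card]
    ring
  have hrank : M.eRk ((T ∪ X : Finset α) : Set α) = ((X.card + 3 : ℕ) : ℕ∞) := by
    rw [hind.eRk_eq_encard, Set.encard_coe_eq_coe_finsetCard, hcard]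
  unfold bracket
  by_cases hle : X.card ≤ 3
  · have hw : IsWitness M T X ↔ 1 ≤ X.card := by
      unfold IsWitness
      rw [hrank]
      constructor
      · rintro ⟨h1, -⟩
        have : 3 < X.card + 3 := by exact_mod_cast h1
        omega
      · intro h1
        constructor
        · exact_mod_cast (by omega : 3 < X.card + 3)
        · exact_mod_cast (by omega : X.card + 3 < 7)
    rw [if_pos (hw.2 hpos), if_pos hle, D_of_indep hind, hcard]
    ring
  · have hw : ¬ IsWitness M T X := by
      unfold IsWitness
      rw [hrank]
      rintro ⟨-, h2⟩
      have : X.card + 3 < 7 := by exact_mod_cast h2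
      omega
    rw [if_neg hw, if_neg hle]
    ring

/-- **No loss beyond three points**: for `|X| ≥ 4` there is no generic term, so the bracket is the (nonnegative) share —
in particular every witness of nullity `3` contributes `≥ 0` (`Γ ≥ 0` of §27.1). -/
theorem bracket_nonneg_of_four_le {T X : Finset α} (hX : 4 ≤ X.card) : 0 ≤ bracket M T X := by
  classical
  unfold bracket
  rw [if_neg (show ¬ (X.card ≤ 3) by omega), sub_zero]
  split_ifs
  · exact div_nonneg zero_le_one (D_nonneg M _)
  · exact le_refl _

end SevenThree

end PercRepro
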